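import Summits.Ventures.PercRepro2.CaseOnePairPocketB
import Summits.Ventures.PercRepro2.CaseOneMarksOnly

/-!
# A statement vertex and a mark in a common pocket hanging at ANY mark are closed
(blind cell PercRepro2, p1 g29; the pair reduction of p1 g27 completed over all marks)

`closedAt_of_pair` (CaseOnePairPocketMain) turns a mark-free-otherwise pocket holding the statement
vertex `a₃` and one further special vertex `z` into the tree gadget `x ~ w ~ {a₃, z}`; `a₃` is then a
leaf at the hub `w`, and the hub's edges in the gadget minus the leaf edge go to the cut vertex `x` and
to `z` (`IsPairPocket.hub_edges_b`). When `z ∈ {o, b}` and `x` is a mark, the hub is a marks-only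
vertex (`closedAt_of_marksOnly`), so the pendant step (`MoveStep.leafMove`) closes `a₃`:
**`closedAt_of_pair_at_mark`**. The two new rows of the S5 table are `a₃` and `o` in a common pocket
at `b` (**`closedAt_of_pair_at_b`**) and `a₃` and `b` in a common pocket at `o`
(**`closedAt_of_pair_at_o`**); the root cases are `closedAt_of_pair_at_root` /
`closedAt_of_pair_at_root_b` again. Own code; standard axioms.
-/

namespace Summit.Ventures.PercRepro2

namespace CaseOne

universe u

section PairMark
variable {V : Type*} [Fintype V] [DecidableEq V] {R : Type*} [Field R] [LinearOrder R]
  [IsStrictOrderedRing R] {E : Type u} [Fintype E] [DecidableEq E]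
variable {ends : E → Sym2 V} {W : Set V} {x : V} {P : Finset E} {e₁ e₂ e₃ : E} {w : V}
  {o a₁ a₂ a₃ b z : V}

/-- **A statement vertex and a mark `z ∈ {o, b}` in a common mark-free-otherwise pocket hanging at a
mark `x ∈ {a₁, a₂, o, b}` are closed.** -/
theorem closedAt_of_pair_at_mark (hh : IsPairPocket ends W x P e₁ e₂ e₃ w a₃ z)
    (hz : z = o ∨ z = b) (hx : x = a₁ ∨ x = a₂ ∨ x = o ∨ x = b) (h1 : a₁ ∉ W) (h2 : a₂ ∉ W)
    (ho : o ∉ W ∨ o = z) (hb : b ∉ W ∨ b = z) : ClosedAt R o a₁ a₂ b E ends a₃ := by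
  refine closedAt_of_pair hh h1 h2 (ho.elim Or.inl fun h => Or.inr (Or.inr h))
    (Or.inr (Or.inl rfl)) (hb.elim Or.inl fun h => Or.inr (Or.inr h)) ?_
  have hoa : o ≠ a₃ := by
    rcases ho with ho | rfl
    · rintro rfl
      exact ho hh.mem_z₁
    · exact hh.ne_z.symm
  have hba : b ≠ a₃ := by
    rcases hb with hb | rfl
    · rintro rfl
      exact hb hh.mem_z₁
    · exact hh.ne_z.symm
  have h1a : a₁ ≠ a₃ := by
    rintro rfl
    exact h1 hh.mem_z₁
  have h2a : a₂ ≠ a₃ := by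
    rintro rfl
    exact h2 hh.mem_z₁
  -- the hub of the gadget minus the leaf edge is a marks-only vertex
  obtain ⟨hE1, hE3, huniq⟩ := hh.hub_edges_b
  have hmarks : ∀ e : {e : E // e ≠ e₂},
      w ∈ restrictEnds (pairEnds ends P e₁ e₂ e₃ x w a₃ z) e₂ e →
        restrictEnds (pairEnds ends P e₁ e₂ e₃ x w a₃ z) e₂ e = s(a₁, w) ∨
        restrictEnds (pairEnds ends P e₁ e₂ e₃ x w a₃ z) e₂ e = s(a₂, w) ∨
        restrictEnds (pairEnds ends P e₁ e₂ e₃ x w a₃ z) e₂ e = s(o, w) ∨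
        restrictEnds (pairEnds ends P e₁ e₂ e₃ x w a₃ z) e₂ e = s(b, w) := by
    intro e hmem
    rcases huniq e hmem with rfl | rfl
    · rw [hE1]
      rcases hx with rfl | rfl | rfl | rfl
      · exact Or.inl rfl
      · exact Or.inr (Or.inl rfl)
      · exact Or.inr (Or.inr (Or.inl rfl))
      · exact Or.inr (Or.inr (Or.inr rfl))
    · rw [hE3]
      rcases hz with rfl | rfl
      · exact Or.inr (Or.inr (Or.inl rfl))
      · exact Or.inr (Or.inr (Or.inr rfl))
  -- the pendant step from the hub to `a₃`
  have hmove : Moves o a₁ a₂ b {e : E // e ≠ e₂}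
      (restrictEnds (pairEnds ends P e₁ e₂ e₃ x w a₃ z) e₂) w E
      (pairEnds ends P e₁ e₂ e₃ x w a₃ z) a₃ :=
    Moves.tail (Moves.refl _ _ _)
      (MoveStep.leafMove E (pairEnds ends P e₁ e₂ e₃ x w a₃ z) w a₃ e₂ hh.isLeafAt_hub hoa h1a h2a
        hba)
  exact closedAt_of_moves hmove (closedAt_of_marksOnly hmarks)

/-- **`a₃` and the mark `o` in a common mark-free-otherwise pocket hanging at `b` are closed.** -/
theorem closedAt_of_pair_at_b (hh : IsPairPocket ends W b P e₁ e₂ e₃ w a₃ o) (h1 : a₁ ∉ W)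
    (h2 : a₂ ∉ W) : ClosedAt R o a₁ a₂ b E ends a₃ :=
  closedAt_of_pair_at_mark hh (Or.inl rfl) (Or.inr (Or.inr (Or.inr rfl))) h1 h2 (Or.inr rfl)
    (Or.inl hh.pocket.x_not_mem)

/-- **`a₃` and the mark `b` in a common mark-free-otherwise pocket hanging at `o` are closed.** -/
theorem closedAt_of_pair_at_o (hh : IsPairPocket ends W o P e₁ e₂ e₃ w a₃ b) (h1 : a₁ ∉ W)
    (h2 : a₂ ∉ W) : ClosedAt R o a₁ a₂ b E ends a₃ :=
  closedAt_of_pair_at_mark hh (Or.inr rfl) (Or.inr (Or.inr (Or.inl rfl))) h1 h2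
    (Or.inl hh.pocket.x_not_mem) (Or.inr rfl)

/-- `(J1₁)` at a statement vertex sharing a pocket at a mark with `o` or `b`. -/
theorem jOneOne_of_pair_at_mark (hh : IsPairPocket ends W x P e₁ e₂ e₃ w a₃ z)
    (hz : z = o ∨ z = b) (hx : x = a₁ ∨ x = a₂ ∨ x = o ∨ x = b) (h1 : a₁ ∉ W) (h2 : a₂ ∉ W)
    (ho : o ∉ W ∨ o = z) (hb : b ∉ W ∨ b = z) (p : E → R) (hp : IsProbVec p) :
    JOneOne p ends o a₁ a₂ a₃ b :=
  jOneOne_of_i_of_ii p ends o a₁ a₂ a₃ b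
    (closedAt_of_pair_at_mark hh hz hx h1 h2 ho hb p hp).2.2.1
    (closedAt_of_pair_at_mark hh hz hx h1 h2 ho hb p hp).1

end PairMark

end CaseOne

end Summit.Ventures.PercRepro2
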